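import Mathlib
import Summits.NavierStokesRegularity.FluidComputer.TransportGalerkinFourierDictionary
import Literature.Analysis.FunctionSpaces.TorusFourierSeries
import Literature.Analysis.FunctionSpaces.TorusFourierModes
import Literature.Analysis.FunctionSpaces.TorusLerayHelmholtzProofs
import Literature.Analysis.FunctionSpaces.TorusTrigPoly
import HarnessLib

/-!
# A classical solution of the perturbed Navier–Stokes system obeys the transport Galerkin ODE MODE BY MODE (instab g20, cell `ns-blowup`, 2026-08-27)

HONEST FRAMING (human ruling D-0035): nothing here is a claim about Navier–Stokes blow-up.
WHAT THIS IS NOT: not NS evidence — the time-dependent half of the DICTIONARY of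
`TransportGalerkinFourierDictionary`, at the level of single Fourier modes; no flow, certificate,
number or census word moves.

PURPOSE. `TransportGalerkinFourierDictionary.leray_field_eq_mFourierCoeff` identifies the lattice
field of the R-β chain with the Leray–Fourier image of the classical perturbation expression for a
complexified field. Here, entirely with REAL fields and the tree's torus calculus:

* `mFourierCoeff_complexify_gradient_eq` — `𝓕(∇θ)(k) = (2πi θ̂(k)) • k` as a vector identity
  (`Torus.mFourierCoeff_complexify_gradient_apply_eq`);
* `field_proj_eq_mFourierCoeff_real` — for smooth real `U`, `u` on `𝕋³`:
  `linCoeff ν Û proj û (k) + bilCoeff proj û û (k) = 𝓕[ νΔu − ((U·∇)u + (u·∇)U) − (u·∇)u ](k)`, all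
  four terms real fields (`Torus.laplacian`, `Torus.convect`), complexified under `𝓕`
  (`Torus.mFourierCoeff_complexify_laplacian`, `SteadyLattice.mFourierCoeff_convect_real`);
* **`hasDerivAt_mFourierCoeff_of_perturbationEq`** — THE MODEWISE TRANSFER: if `u : ℝ → 𝕋³ → ℝ³` is
  smooth in space–time, every slice is divergence free with vanishing zero mode, and at time `t` the
  classical perturbation equation about the smooth real host `U` holds pointwise with some smooth
  pressure `q`,
  `∂ₜu = νΔu − (U·∇)u − (u·∇)U − (u·∇)u − ∇q`,
  then for EVERY mode `k` the coefficient `s ↦ 𝓕(u s)(k)` is differentiable at `t` with derivative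
  `Π_k (linCoeff ν Û proj û(t) + bilCoeff proj û(t) û(t))(k)` — the `k`-th (unscaled) coefficient of the
  model's field (time derivative of coefficients by `Torus.hasDerivAt_mFourierCoeff_slice`; the pressure
  is killed by `Π_k`; the derivative family is transversal with zero mean as a limit of such families, so
  `Π_k` fixes it).

What is NOT done: the same derivative as ONE `E`-valued (`ℓ²`, `H²`-scaled) derivative — the last step
before the chain's uniqueness theorems (`TransportGalerkinUnique.eqOn_of_smooth_solutions`) apply to
classical PDE solutions verbatim. `d = 3`; Mathlib + the tree files cited; no new definitions.
-/

noncomputable section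

namespace Summit.NavierStokesRegularity.FluidComputer.TransportGalerkinFourierTransfer

open Set Filter Topology Finset MeasureTheory UnitAddTorus
open Literature.Analysis.FunctionSpaces Literature.Analysis.FunctionSpaces.Lattice
open Literature.Analysis.FunctionSpaces.Torus Literature.Analysis.FunctionSpaces.EuclideanSpace
open Literature.Analysis.ODE
open Literature.Analysis.FluidPDE Literature.Analysis.FluidPDE.ScalarFourier
open Literature.Analysis.FluidPDE.SteadyLattice
open Summit.NavierStokesRegularity.FluidComputer.GalerkinLatticePhaseSpace
open Summit.NavierStokesRegularity.FluidComputer.TransportGalerkin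
open Summit.NavierStokesRegularity.FluidComputer.TransportGalerkinRapid
open Summit.NavierStokesRegularity.FluidComputer.TransportGalerkinAbc
open Summit.NavierStokesRegularity.FluidComputer.TransportGalerkinEigen
open Summit.NavierStokesRegularity.FluidComputer.TransportGalerkinEigenFourier
open Summit.NavierStokesRegularity.FluidComputer.TransportGalerkinFourierDictionary
open scoped ENNReal NNReal ComplexConjugate InnerProductSpace

/-! ## §1 The real dictionary -/

section Real

/-- **`𝓕(∇θ)(k) = (2πi θ̂(k)) • k`** for a smooth real `θ` on `𝕋³` (vector form of
`Torus.mFourierCoeff_complexify_gradient_apply_eq`). -/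
theorem mFourierCoeff_complexify_gradient_eq {θ : UnitAddTorus (Fin 3) → ℝ} (hθ : IsSmooth θ) (k : Fin 3 → ℤ) :
    mFourierCoeff (complexify ∘ Torus.gradient θ) k =
      (2 * Real.pi * Complex.I * mFourierCoeff (fun x => (θ x : ℂ)) k) • Torus.freqVec k := by
  ext j
  rw [mFourierCoeff_complexify_gradient_apply_eq hθ k j, PiLp.smul_apply, Torus.freqVec, PiLp.toLp_apply,
    smul_eq_mul]
  ring

/-- **The model's field IS the Fourier transform of the classical perturbation expression — real
form** (`field_proj_eq_mFourierCoeff_real`): for smooth real `U`, `u` on `𝕋³` and every mode `k`,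
`linCoeff ν Û proj û (k) + bilCoeff proj û û (k) = 𝓕[ νΔu − ((U·∇)u + (u·∇)U) − (u·∇)u ](k)`
(`Û = 𝓕(complexify ∘ U)`, `û = 𝓕(complexify ∘ u)`). -/
theorem field_proj_eq_mFourierCoeff_real {ν : ℝ} {U u : UnitAddTorus (Fin 3) → EuclideanSpace ℝ (Fin 3)}
    (hU : IsSmooth U) (hu : IsSmooth u) (k : Fin 3 → ℤ) :
    linCoeff ν (mFourierCoeff (complexify ∘ U)) (fun j => (EuclideanSpace.proj j : EuclideanSpace ℂ (Fin 3) →L[ℂ] ℂ))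
        (mFourierCoeff (complexify ∘ u)) k +
      bilCoeff (fun j => (EuclideanSpace.proj j : EuclideanSpace ℂ (Fin 3) →L[ℂ] ℂ))
        (mFourierCoeff (complexify ∘ u)) (mFourierCoeff (complexify ∘ u)) k =
    mFourierCoeff (complexify ∘ fun y => ν • laplacian u y
        - (Torus.convect U u y + Torus.convect u U y) - Torus.convect u u y) k := by
  have hUr : RapidDecay (mFourierCoeff (complexify ∘ U)) := hU.complexify_comp.rapidDecay_mFourierCoeff
  have hur : RapidDecay (mFourierCoeff (complexify ∘ u)) := hu.complexify_comp.rapidDecay_mFourierCoeff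
  rw [linCoeff_proj_apply hUr hur k, bilCoeff_proj_apply hur hur k]
  -- the right-hand side, term by term
  have i1 : Integrable (complexify ∘ laplacian u) volume := hu.laplacian.complexify_comp.integrable
  have i1' : Integrable ((ν : ℂ) • (complexify ∘ laplacian u)) volume := i1.smul (ν : ℂ)
  have i2 : Integrable (complexify ∘ Torus.convect U u) volume := (hU.convect hu).complexify_comp.integrable
  have i3 : Integrable (complexify ∘ Torus.convect u U) volume := (hu.convect hU).complexify_comp.integrable
  have i4 : Integrable (complexify ∘ Torus.convect u u) volume := (hu.convect hu).complexify_comp.integrable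
  have hfun : (complexify ∘ fun y => ν • laplacian u y - (Torus.convect U u y + Torus.convect u U y) - Torus.convect u u y) =
      ((ν : ℂ) • (complexify ∘ laplacian u)) - (complexify ∘ Torus.convect U u + complexify ∘ Torus.convect u U)
        - complexify ∘ Torus.convect u u := by
    funext y
    ext i
    simp only [Function.comp_apply, complexify_apply, Pi.sub_apply, Pi.add_apply, Pi.smul_apply, PiLp.sub_apply,
      PiLp.add_apply, PiLp.smul_apply, smul_eq_mul]
    push_cast
    ring
  rw [hfun, mFourierCoeff_sub (i1'.sub (i2.add i3)) i4, mFourierCoeff_sub i1' (i2.add i3), mFourierCoeff_add i2 i3,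
    mFourierCoeff_const_smul, mFourierCoeff_complexify_laplacian hu k, mFourierCoeff_convect_real hU hu k,
    mFourierCoeff_convect_real hu hU k, mFourierCoeff_convect_real hu hu k]
  push_cast
  rw [smul_neg, smul_smul]
  abel

end Real

/-! ## §2 The modewise transfer -/

section Transfer

/-- **A classical solution of the perturbed system obeys the lattice ODE mode by mode**
(`hasDerivAt_mFourierCoeff_of_perturbationEq`). Host: `U` smooth real. Perturbation:
`u : ℝ → 𝕋³ → ℝ³` smooth in space–time (`IsSmoothSpaceTimeOn univ u`), every slice divergence free
with vanishing zero mode. Equation at time `t`, pointwise, with a smooth real pressure `q`: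
`∂ₜu(t) = νΔu(t) − ((U·∇)u(t) + (u(t)·∇)U) − (u(t)·∇)u(t) − ∇q`. Conclusion: for every mode `k`,
`s ↦ 𝓕(u s)(k)` has derivative `Π_k (linCoeff ν Û proj û(t) + bilCoeff proj û(t) û(t))(k)` at `t`. -/
theorem hasDerivAt_mFourierCoeff_of_perturbationEq {ν : ℝ} {U : UnitAddTorus (Fin 3) → EuclideanSpace ℝ (Fin 3)}
    (hU : IsSmooth U) {u : ℝ → UnitAddTorus (Fin 3) → EuclideanSpace ℝ (Fin 3)} (hu : IsSmoothSpaceTimeOn univ u)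
    (hdiv : ∀ s, IsDivFree (u s)) (h0 : ∀ s, mFourierCoeff (complexify ∘ u s) 0 = 0)
    {q : UnitAddTorus (Fin 3) → ℝ} (hq : IsSmooth q) {t : ℝ}
    (heq : ∀ y, Torus.timeDeriv u t y = ν • laplacian (u t) y
      - (Torus.convect U (u t) y + Torus.convect (u t) U y) - Torus.convect (u t) (u t) y - Torus.gradient q y)
    (k : Fin 3 → ℤ) :
    HasDerivAt (fun s => mFourierCoeff (complexify ∘ u s) k)
      (lerayCLM k
        (linCoeff ν (mFourierCoeff (complexify ∘ U)) (fun j => (EuclideanSpace.proj j : EuclideanSpace ℂ (Fin 3) →L[ℂ] ℂ))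
            (mFourierCoeff (complexify ∘ u t)) k +
          bilCoeff (fun j => (EuclideanSpace.proj j : EuclideanSpace ℂ (Fin 3) →L[ℂ] ℂ))
            (mFourierCoeff (complexify ∘ u t)) (mFourierCoeff (complexify ∘ u t)) k)) t := by
  have hut : IsSmooth (u t) := hu.isSmooth_slice (mem_univ t)
  -- the derivative family `D k' = 𝓕(∂ₜu(t))(k')`
  have hder : ∀ k', HasDerivAt (fun s => mFourierCoeff (complexify ∘ u s) k')
      (mFourierCoeff (complexify ∘ Torus.timeDeriv u t) k') t := fun k' => Torus.hasDerivAt_mFourierCoeff_slice hu k' t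
  -- `D` is transversal: differentiate the identity `∑_j k_j û_j(s) = 0`
  have hDt : ∀ k' : Fin 3 → ℤ, ∑ j : Fin 3, ((k' j : ℤ) : ℂ) * mFourierCoeff (complexify ∘ Torus.timeDeriv u t) k' j = 0 := by
    intro k'
    have hj : ∀ j : Fin 3, HasDerivAt (fun s => mFourierCoeff (complexify ∘ u s) k' j)
        (mFourierCoeff (complexify ∘ Torus.timeDeriv u t) k' j) t := fun j =>
      ((EuclideanSpace.proj j : EuclideanSpace ℂ (Fin 3) →L[ℂ] ℂ).restrictScalars ℝ).hasFDerivAt.comp_hasDerivAt t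
        (hder k')
    have hsum := HasDerivAt.sum (u := (Finset.univ : Finset (Fin 3))) (x := t)
      (A := fun j s => ((k' j : ℤ) : ℂ) * mFourierCoeff (complexify ∘ u s) k' j)
      (A' := fun j => ((k' j : ℤ) : ℂ) * mFourierCoeff (complexify ∘ Torus.timeDeriv u t) k' j)
      (fun j _ => (hj j).const_mul _)
    have h2 : HasDerivAt (fun _ : ℝ => (0 : ℂ))
        (∑ j : Fin 3, ((k' j : ℤ) : ℂ) * mFourierCoeff (complexify ∘ Torus.timeDeriv u t) k' j) t :=
      hsum.congr_of_eventuallyEq (Filter.Eventually.of_forall fun s =>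
        ((hdiv s).sum_mul_mFourierCoeff_eq_zero (hu.isSmooth_slice (mem_univ s)) k').symm)
    exact ((hasDerivAt_const t (0 : ℂ)).unique h2).symm
  -- `D` has vanishing zero mode: differentiate `û(s)(0) = 0`
  have hD0 : mFourierCoeff (complexify ∘ Torus.timeDeriv u t) 0 = 0 := by
    have h2 : HasDerivAt (fun _ : ℝ => (0 : EuclideanSpace ℂ (Fin 3))) (mFourierCoeff (complexify ∘ Torus.timeDeriv u t) 0) t :=
      (hder 0).congr_of_eventuallyEq (Filter.Eventually.of_forall fun s => (h0 s).symm)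
    exact ((hasDerivAt_const t (0 : EuclideanSpace ℂ (Fin 3))).unique h2).symm
  -- hence `Π` fixes `D`
  have hfix : lerayCLM k (mFourierCoeff (complexify ∘ Torus.timeDeriv u t) k) = mFourierCoeff (complexify ∘ Torus.timeDeriv u t) k :=
    lerayCLM_apply_of_transversal hDt hD0 k
  -- `D` through the equation: field minus pressure gradient
  have hD : mFourierCoeff (complexify ∘ Torus.timeDeriv u t) k =
      (linCoeff ν (mFourierCoeff (complexify ∘ U)) (fun j => (EuclideanSpace.proj j : EuclideanSpace ℂ (Fin 3) →L[ℂ] ℂ))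
          (mFourierCoeff (complexify ∘ u t)) k +
        bilCoeff (fun j => (EuclideanSpace.proj j : EuclideanSpace ℂ (Fin 3) →L[ℂ] ℂ))
          (mFourierCoeff (complexify ∘ u t)) (mFourierCoeff (complexify ∘ u t)) k) -
      (2 * Real.pi * Complex.I * mFourierCoeff (fun x => (q x : ℂ)) k) • Torus.freqVec k := by
    have htd : Torus.timeDeriv u t = (fun y => ν • laplacian (u t) y
        - (Torus.convect U (u t) y + Torus.convect (u t) U y) - Torus.convect (u t) (u t) y) - Torus.gradient q :=
      funext fun y => by rw [heq y, Pi.sub_apply]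
    have iG : Integrable (complexify ∘ fun y => ν • laplacian (u t) y
        - (Torus.convect U (u t) y + Torus.convect (u t) U y) - Torus.convect (u t) (u t) y) volume := by
      have h := ((hut.laplacian.complexify_comp.integrable.smul (ν : ℂ)).sub
        (((hU.convect hut).complexify_comp.integrable).add ((hut.convect hU).complexify_comp.integrable))).sub
        ((hut.convect hut).complexify_comp.integrable)
      refine h.congr (Filter.Eventually.of_forall fun y => ?_)
      ext i
      simp only [Function.comp_apply, complexify_apply, Pi.sub_apply, Pi.add_apply, Pi.smul_apply, PiLp.sub_apply,
        PiLp.add_apply, PiLp.smul_apply, smul_eq_mul]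
      push_cast
      ring
    have iP : Integrable (complexify ∘ Torus.gradient q) volume := hq.gradient.complexify_comp.integrable
    rw [htd, complexify_comp_sub, mFourierCoeff_sub iG iP, ← field_proj_eq_mFourierCoeff_real hU hut k,
      mFourierCoeff_complexify_gradient_eq hq k]
  -- assemble: `D = Π D = Π(field) − c • Π k = Π(field)`
  refine (hder k).congr_deriv ?_
  rw [← hfix, hD, map_sub, map_smul, lerayCLM_apply (k := k) (c := Torus.freqVec k), lerayCoeff_freqVec,
    smul_zero, sub_zero]

end Transfer

end Summit.NavierStokesRegularity.FluidComputer.TransportGalerkinFourierTransfer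

end
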